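import Summits.BirchSwinnertonDyer.BirchSwinnertonDyer.Theorems.ResidualThetaTransportAtTwoPlusDualThetaExtraction
import HarnessLib

/-!
# θ-EXTRACTION at `p = 2` in the fixed-point currency `S[2^J, φ^{2ⁿ} = 1]`

Support file for RTT P6 `ResidualLambdaFormulaNegDiscAtTwo` (stmt-BirchSwinnertonDyer-23110), line `hplusdual`, stub `stub_iso`
(ISO θ-plan). `forall_layerForm_eq_zero_two` (`…PlusDualThetaExtraction`) describes the layers by `ω_n(φ − 1) s = 0`; the LEAD's
realization dictionary (`…RlfLayerIsoRealization`) describes them by `φ^{2ⁿ} s = s`. This file records the bridge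
`aeval_sub_one_cyclotomicOmega_apply_eq_zero_iff` and the same extraction theorem in the fixed-point currency,
`forall_layerForm_eq_zero_two'`. Nothing is closed; 23110 is NOT proved; BSD is not proved by any of this.

References: B.D. Kim, Compos. Math. 143 (2007), Props. 3.15, 3.18.
-/

set_option autoImplicit false
-- D-0017: single-problem summit, so `Summit.BirchSwinnertonDyer.BirchSwinnertonDyer.…` repeats a namespace BY DESIGN.
set_option linter.dupNamespace false

noncomputable section

open scoped Classical
open Polynomial Literature.NumberTheory.EllipticCurves Literature.NumberTheory.EllipticCurves.IwasawaDual

namespace Summit.BirchSwinnertonDyer.BirchSwinnertonDyer.Theorems.ResidualThetaLayer.PlusDual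

section Two

variable {S : Type*} [AddCommGroup S] {φ : AddMonoid.End S}

omit [AddCommGroup S] in
/-- **`ω_n(φ − 1) s = 0 ↔ φ^{pⁿ} s = s`** (`ω_n = (T+1)^{pⁿ} − 1`): the two descriptions of the layer agree.
[cite: Pollack2003, Thm. 6.17] -/
theorem aeval_sub_one_cyclotomicOmega_apply_eq_zero_iff {S : Type*} [AddCommGroup S] (φ : AddMonoid.End S) (p n : ℕ) (s : S) :
    aeval (φ - 1) (cyclotomicOmega p n) s = 0 ↔ (φ ^ p ^ n) s = s := by
  rw [cyclotomicOmega, map_sub, map_pow, map_add, aeval_X, map_one, sub_add_cancel]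
  exact sub_eq_zero

variable {Xd : Type*} [AddCommGroup Xd] [Module (PowerSeries ℤ_[2]) Xd] {toDual : Xd →+ (S →+ AddCircle (1 : ℚ))}

/-- **θ-EXTRACTION AT `p = 2`, fixed-point currency.** Same statement as `forall_layerForm_eq_zero_two` with every layer condition
written `2^J • s = 0 ∧ φ^{2ⁿ} s = s` (the currency of the LEAD's realization dictionary `point_mem_layer_of_witness` /
`exists_witness_of_mem_layer`): biadditive, `φ`-invariant, norm-compatible (`B n (s + φ^{2ⁿ}s) t = B (n+1) s t`) forms
`B n : S → S → ℤ/2^J` on the layers which vanish on `ω̃⁻_{2k}(φ−1)·S[2^J, φ^{2^{2k}} = 1]` (the honest plus classes, (d′)) are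
identically zero. [cite: BDKim2007, Prop. 3.15, Prop. 3.18] -/
theorem forall_layerForm_eq_zero_two' (h : IsDualPair 2 (φ - 1) toDual) (e : Xd ≃ₗ[PowerSeries ℤ_[2]] PowerSeries ℤ_[2])
    (J : ℕ) (B : ℕ → S → S → ZMod (2 ^ J))
    (hadd₁ : ∀ (n : ℕ) (s₁ s₂ t : S), 2 ^ J • s₁ = 0 ∧ (φ ^ 2 ^ n) s₁ = s₁ → 2 ^ J • s₂ = 0 ∧ (φ ^ 2 ^ n) s₂ = s₂ →
      2 ^ J • t = 0 ∧ (φ ^ 2 ^ n) t = t → B n (s₁ + s₂) t = B n s₁ t + B n s₂ t)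
    (hadd₂ : ∀ (n : ℕ) (s t₁ t₂ : S), 2 ^ J • s = 0 ∧ (φ ^ 2 ^ n) s = s → 2 ^ J • t₁ = 0 ∧ (φ ^ 2 ^ n) t₁ = t₁ →
      2 ^ J • t₂ = 0 ∧ (φ ^ 2 ^ n) t₂ = t₂ → B n s (t₁ + t₂) = B n s t₁ + B n s t₂)
    (hinv : ∀ (n : ℕ) (s t : S), 2 ^ J • s = 0 ∧ (φ ^ 2 ^ n) s = s → 2 ^ J • t = 0 ∧ (φ ^ 2 ^ n) t = t →
      B n (φ s) (φ t) = B n s t)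
    (hnorm : ∀ (n : ℕ) (s t : S), 2 ^ J • s = 0 ∧ (φ ^ 2 ^ (n + 1)) s = s → 2 ^ J • t = 0 ∧ (φ ^ 2 ^ n) t = t →
      B n (s + (φ ^ 2 ^ n) s) t = B (n + 1) s t)
    (hV : ∀ (k : ℕ) (s t : S), 2 ^ J • s = 0 ∧ (φ ^ 2 ^ (2 * k)) s = s → 2 ^ J • t = 0 ∧ (φ ^ 2 ^ (2 * k)) t = t →
      B (2 * k) (aeval (φ - 1) (cyclotomicOmegaMinus 2 (2 * k)) s) (aeval (φ - 1) (cyclotomicOmegaMinus 2 (2 * k)) t) = 0) :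
    ∀ (n : ℕ) (s t : S), 2 ^ J • s = 0 ∧ (φ ^ 2 ^ n) s = s → 2 ^ J • t = 0 ∧ (φ ^ 2 ^ n) t = t → B n s t = 0 := by
  have hω := aeval_sub_one_cyclotomicOmega_apply_eq_zero_iff φ 2
  intro n s t hs ht
  exact forall_layerForm_eq_zero_two h e J B
    (fun n s₁ s₂ t h₁ h₂ h₃ ↦ hadd₁ n s₁ s₂ t ⟨h₁.1, (hω n s₁).mp h₁.2⟩ ⟨h₂.1, (hω n s₂).mp h₂.2⟩ ⟨h₃.1, (hω n t).mp h₃.2⟩)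
    (fun n s t₁ t₂ h₁ h₂ h₃ ↦ hadd₂ n s t₁ t₂ ⟨h₁.1, (hω n s).mp h₁.2⟩ ⟨h₂.1, (hω n t₁).mp h₂.2⟩ ⟨h₃.1, (hω n t₂).mp h₃.2⟩)
    (fun n s t h₁ h₂ ↦ hinv n s t ⟨h₁.1, (hω n s).mp h₁.2⟩ ⟨h₂.1, (hω n t).mp h₂.2⟩)
    (fun n s t h₁ h₂ ↦ hnorm n s t ⟨h₁.1, (hω (n + 1) s).mp h₁.2⟩ ⟨h₂.1, (hω n t).mp h₂.2⟩)
    (fun k s t h₁ h₂ ↦ hV k s t ⟨h₁.1, (hω (2 * k) s).mp h₁.2⟩ ⟨h₂.1, (hω (2 * k) t).mp h₂.2⟩)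
    n s t ⟨hs.1, (hω n s).mpr hs.2⟩ ⟨ht.1, (hω n t).mpr ht.2⟩

/-- **θ-EXTRACTION AT `p = 2`, fixed-point layers and HONEST-IMAGE vanishing.** As `forall_layerForm_eq_zero_two'`, with the
vanishing hypothesis (V) stated on the honest image SET of (d′) — `s, t ∈ ω̃⁻_{2k}(φ−1) '' {s | 2^J s = 0, ω_{2k}(φ−1) s = 0}` — the
exact membership consumed by the LEAD's `LayerIsoAssembly.exists_honest_witness`. [cite: BDKim2007, Prop. 3.15, Prop. 3.18] -/
theorem forall_layerForm_eq_zero_two'' (h : IsDualPair 2 (φ - 1) toDual) (e : Xd ≃ₗ[PowerSeries ℤ_[2]] PowerSeries ℤ_[2])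
    (J : ℕ) (B : ℕ → S → S → ZMod (2 ^ J))
    (hadd₁ : ∀ (n : ℕ) (s₁ s₂ t : S), 2 ^ J • s₁ = 0 ∧ (φ ^ 2 ^ n) s₁ = s₁ → 2 ^ J • s₂ = 0 ∧ (φ ^ 2 ^ n) s₂ = s₂ →
      2 ^ J • t = 0 ∧ (φ ^ 2 ^ n) t = t → B n (s₁ + s₂) t = B n s₁ t + B n s₂ t)
    (hadd₂ : ∀ (n : ℕ) (s t₁ t₂ : S), 2 ^ J • s = 0 ∧ (φ ^ 2 ^ n) s = s → 2 ^ J • t₁ = 0 ∧ (φ ^ 2 ^ n) t₁ = t₁ →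
      2 ^ J • t₂ = 0 ∧ (φ ^ 2 ^ n) t₂ = t₂ → B n s (t₁ + t₂) = B n s t₁ + B n s t₂)
    (hinv : ∀ (n : ℕ) (s t : S), 2 ^ J • s = 0 ∧ (φ ^ 2 ^ n) s = s → 2 ^ J • t = 0 ∧ (φ ^ 2 ^ n) t = t →
      B n (φ s) (φ t) = B n s t)
    (hnorm : ∀ (n : ℕ) (s t : S), 2 ^ J • s = 0 ∧ (φ ^ 2 ^ (n + 1)) s = s → 2 ^ J • t = 0 ∧ (φ ^ 2 ^ n) t = t →
      B n (s + (φ ^ 2 ^ n) s) t = B (n + 1) s t)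
    (hV : ∀ (k : ℕ) (s t : S),
      s ∈ (⇑(aeval (φ - 1) (cyclotomicOmegaMinus 2 (2 * k)))) ''
        {s : S | 2 ^ J • s = 0 ∧ aeval (φ - 1) (cyclotomicOmega 2 (2 * k)) s = 0} →
      t ∈ (⇑(aeval (φ - 1) (cyclotomicOmegaMinus 2 (2 * k)))) ''
        {s : S | 2 ^ J • s = 0 ∧ aeval (φ - 1) (cyclotomicOmega 2 (2 * k)) s = 0} → B (2 * k) s t = 0) :
    ∀ (n : ℕ) (s t : S), 2 ^ J • s = 0 ∧ (φ ^ 2 ^ n) s = s → 2 ^ J • t = 0 ∧ (φ ^ 2 ^ n) t = t → B n s t = 0 := by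
  have hω := aeval_sub_one_cyclotomicOmega_apply_eq_zero_iff φ 2
  exact forall_layerForm_eq_zero_two' h e J B hadd₁ hadd₂ hinv hnorm fun k s t h₁ h₂ ↦
    hV k _ _ (Set.mem_image_of_mem _ ⟨h₁.1, (hω (2 * k) s).mpr h₁.2⟩) (Set.mem_image_of_mem _ ⟨h₂.1, (hω (2 * k) t).mpr h₂.2⟩)

end Two

end Summit.BirchSwinnertonDyer.BirchSwinnertonDyer.Theorems.ResidualThetaLayer.PlusDual

end
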